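import Summits.ResolutionOfSingularities.ResolutionOfSingularities.Theorems.PurelyInseparableDim4ResConeCInfLayerPrime
import Summits.ResolutionOfSingularities.ResolutionOfSingularities.Theorems.PurelyInseparableDim4ResConeCInfLegalityPrime
import Summits.ResolutionOfSingularities.ResolutionOfSingularities.Theorems.PurelyInseparableDim4ResConeCInfWindowToolsPrime
import Summits.ResolutionOfSingularities.ResolutionOfSingularities.Theorems.PurelyInseparableDim4SwapTransportReadOne
import HarnessLib
import HarnessLib.Audit.Tags

/-!
# Purely inseparable four-folds — A TRANSLATED SLOT CHILD IN REGIME IS STRAIGHT, FOR EVERY PRIME: `e_G = 3` plus the exact pair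
# ledger force the residual cone to be `a·x_f^d` (cell `res-dim4-pi`, K2(p) lane, rung-1 POWER-CONE LINE «light pair of TAIL(p, p−1, 3)
# ∀ p», flagless branch, the LOOK-AHEAD input of FILE ♯7; seat res-dim4-typ-1 g6)

[OURS · counted 0 · cell `res-dim4-pi` · K2(p) lane (holder res-dim4-p-12 g5, ruling g5-23); res-dim4-p-3 g6's MEMO FLAGLESS♯ §1 (F1)
«straightness of the child is automatic from the exact ledger», kernel route of res-dim4-typ-1 g6's ♯7 design note (bus 2026-08-29 14:20Z,
point (c)).]  Nothing here proves K2(p) for any `p`, any TAIL(p, p−1, 3), FLAGLESS♯, `NoIsolatedTrap p p` or resolution of singularities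
in dimension ≥ 4 / characteristic `p` — NOT proved.  AI kernel work, weaker than expert review.  Reading lemmas about OUR frame; they kill
nothing by themselves.

WHY (the look-ahead of the ♯-window).  In the flagless branch the `u`-translation of a real step is pinned by a coefficient of the CHILD
one degree ABOVE its order (res-dim4-p-3's ♯1 `coeff_sharp_step_translate_u`), dead only by the child's LAYER, and LAYER of the child
(♯2b `layer_step_same/_change_prime`) needs the GRANDCHILD «in regime and coordinate-straight» (`hreg₂`).  In the virtual port the
translated virtual child and grandchild are available BEFORE any pinning (W1b's regime-free core, twice), with order `d + 2` and
`e_G = 3` read off the real chain; this file turns that frame-free datum into coordinate-straightness: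
* §1 **`straight_of_finrank_three_of_ledger`** — a state with `r = x_λx_μ ∣ F`, order `d + 2` (`d + 1 = p`), `e_G = 3` and the EXACT
  PAIR LEDGER («contact exponent `≤ d − 1` ⇒ `λ`-, `μ`-exponents `≥ 2`») has `resForm = a·x_f^d`, `a ≠ 0`: `e_G = 3` makes the residual
  cone `c·ℓ^d` (`resForm_eq_C_mul_pow_of_finrank_eq_three`), and the ledger kills the degree-`d` residual monomials `x_i x_f^{d−1}`,
  `x_i^d` (`i ≠ f`), so `ℓ ∝ x_f` (`linearForm_off_eq_zero_pow`, `(d : K) ≠ 0` as `d < p`).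
* §2 **`translated_child_frame_prime`** — a slot step `step p univ j (update 0 u β) s`, ANY `β`, from a straight exact-ledger state of
  order `d + 2`, whose child has order `d + 2` and `e_G = 3`, has: the same weights, `x^r ∣`, the exact ledger (res-dim4-p-3 ♯2
  `ledger_step_translate_u`), hence `resForm = a′·x_f^d` (§1), and the support dress «degree `d + 2` ⇒ the cone `x_λx_μx_f^d`» that
  ♯2b's `hstraight` / `hreg₂` binders ask for.
[cite: CossartJannsenSaito2020, Thm. 3.14] [cite: Hauser2010, §§F–G]
bears_on: LADDER-RESOLUTION:D157-DOOR2 (res-dim4-pi · K2(p) · power cones · flagless branch ♯7 look-ahead: translated children are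
straight).  Supports stmt-ResolutionOfSingularities-16155 (helper).
-/

set_option linter.dupNamespace false -- mandated namespace of this single-conjunct summit

noncomputable section

namespace Summit.ResolutionOfSingularities.ResolutionOfSingularities.Theorems.PIDim4

namespace ResCone

open MvPolynomial Finset
open Literature.AlgebraicGeometry.Resolution
open Literature.AlgebraicGeometry.Resolution.CentreBlowup
open Literature.AlgebraicGeometry.Resolution.Hauser2010
open Literature.AlgebraicGeometry.Resolution.HauserPerlega2019

variable {K : Type} [Field K]

section Letters

variable {j i u f : Fin 4} (hji : j ≠ i) (hju : j ≠ u) (hjf : j ≠ f) (hiu : i ≠ u) (hif : i ≠ f) (huf : u ≠ f)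
include hji hju hjf hiu hif huf

/-! ## 1. `e_G = 3` and the exact pair ledger make the residual cone `a·x_f^d` -/

omit hju hiu huf in
/-- **`e_G = 3` + EXACT PAIR LEDGER ⇒ STRAIGHT**: a state with `r = x_j x_i`, `x^r ∣ F`, order `d + 2` (`d + 1 = p`), polar-kernel rank
`3` and the exact pair ledger has `resForm = a·x_f^d` with `a ≠ 0`. [OURS] [cite: CossartJannsenSaito2020, Thm. 3.14] -/
theorem straight_of_finrank_three_of_ledger (p : ℕ) [Fact p.Prime] [CharP K p] {d : ℕ} (hdp : d + 1 = p) (hd1 : 1 ≤ d)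
    {s : State K} (hr : s.r = Finsupp.single j 1 + Finsupp.single i 1) (hdiv : ∀ e ∈ s.F.support, s.r ≤ e)
    (ho : ordZero s.F = ((d + 2 : ℕ) : ℕ∞)) (he3 : Module.finrank K (resVertex s) = 3)
    (hled : ∀ e ∈ s.F.support, e f ≤ d - 1 → 2 ≤ e j ∧ 2 ≤ e i) :
    ∃ a : K, a ≠ 0 ∧ resForm s = C a * X f ^ d := by
  classical
  have hp : p.Prime := Fact.out
  have hdK : (d : K) ≠ 0 := fun h => by
    have hdvd := (CharP.cast_eq_zero_iff K p d).mp h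
    have := Nat.le_of_dvd (by omega) hdvd
    omega
  have hrj : s.r j = 1 := by rw [hr]; simp [hji]
  have hri : s.r i = 1 := by rw [hr]; simp [hji.symm]
  have hrf : s.r f = 0 := by rw [hr]; simp [hjf.symm, hif.symm]
  have hrdeg : s.r.degree = 2 := by rw [hr, map_add, Finsupp.degree_single, Finsupp.degree_single]
  obtain ⟨ℓ, c, hℓ0, -, hform⟩ := resForm_eq_C_mul_pow_of_finrank_eq_three p ho (by rw [hrdeg]; omega) he3
  rw [hrdeg, show d + 2 - 2 = d from rfl] at hform
  -- reading a degree-`d` residual coefficient on `F`, and the ledger's dead monomials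
  have hread : ∀ m : Fin 4 →₀ ℕ, m.degree = d → coeff m (C c * (∑ i, C (ℓ i) * X i) ^ d) = coeff (s.r + m) s.F := by
    intro m hm
    rw [← hform, coeff_resForm, NarrowApolarity.coeff_initialForm_of_degree_eq ho (by rw [map_add, hrdeg, hm]; omega)]
  have hdead : ∀ m : Fin 4 →₀ ℕ, m.degree = d → m f ≤ d - 1 → (m j = 0 ∨ m i = 0) →
      coeff m (C c * (∑ i, C (ℓ i) * X i) ^ d) = 0 := by
    intro m hm hmf hor
    rw [hread m hm]
    by_contra hne
    have h := hled _ (mem_support_iff.mpr hne) (by rw [Finsupp.add_apply, hrf, zero_add]; exact hmf)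
    rw [Finsupp.add_apply, Finsupp.add_apply, hrj, hri] at h
    omega
  -- the `x_f^d`-coefficient is not zero: otherwise `ℓ_f = 0` and then every `ℓ_i = 0`
  have hc : coeff (Finsupp.single f d) (C c * (∑ i, C (ℓ i) * X i) ^ d) ≠ 0 := by
    intro h0
    rw [coeff_C_mul, coeff_single_linearFormSum_pow] at h0
    rcases mul_eq_zero.mp h0 with hc0 | hℓf
    · exact resForm_ne_zero ho hdiv (by rw [hform, hc0, C_0, zero_mul])
    · have hℓf0 : ℓ f = 0 := pow_eq_zero_iff (by omega) |>.mp hℓf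
      apply hℓ0
      funext k
      by_cases hkf : k = f
      · rw [hkf, hℓf0]; rfl
      · have hk := hdead (Finsupp.single k d) (Finsupp.degree_single _ _)
          (by rw [Finsupp.single_eq_of_ne (fun h => hkf h.symm)]; exact Nat.zero_le _) (by
            by_cases hkj : k = j
            · right; rw [hkj, Finsupp.single_eq_of_ne hji.symm]
            · left; rw [Finsupp.single_eq_of_ne (Ne.symm hkj)])
        rw [coeff_C_mul, coeff_single_linearFormSum_pow] at hk
        rcases mul_eq_zero.mp hk with hc0 | hℓk
        · exact absurd (by rw [hform, hc0, C_0, zero_mul]) (resForm_ne_zero ho hdiv)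
        · exact pow_eq_zero_iff (by omega) |>.mp hℓk
  -- no `x_k x_f^{d−1}`, `k ≠ f`
  have h0 : ∀ k, k ≠ f → coeff (Finsupp.single k 1 + Finsupp.single f (d - 1)) (C c * (∑ i, C (ℓ i) * X i) ^ d) = 0 := by
    intro k hkf
    refine hdead _ (by rw [map_add, Finsupp.degree_single, Finsupp.degree_single]; omega)
      (by rw [Finsupp.add_apply, Finsupp.single_eq_of_ne (fun h => hkf h.symm), Finsupp.single_eq_same, zero_add]) ?_
    by_cases hkj : k = j
    · right
      rw [hkj, Finsupp.add_apply, Finsupp.single_eq_of_ne hji.symm, Finsupp.single_eq_of_ne hif, add_zero]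
    · left
      rw [Finsupp.add_apply, Finsupp.single_eq_of_ne (Ne.symm hkj), Finsupp.single_eq_of_ne hjf, add_zero]
  have hoff := linearForm_off_eq_zero_pow f hdK hc h0
  have hL : (∑ i, C (ℓ i) * X i : MvPolynomial (Fin 4) K) = C (ℓ f) * X f := by
    rw [← Finset.add_sum_erase _ _ (Finset.mem_univ f)]
    rw [Finset.sum_eq_zero fun k hk => by rw [hoff k (Finset.ne_of_mem_erase hk), C_0, zero_mul], add_zero]
  refine ⟨c * ℓ f ^ d, ?_, ?_⟩
  · intro h0
    apply hc
    rw [coeff_C_mul, coeff_single_linearFormSum_pow, h0]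
  · rw [hform, hL, mul_pow, ← map_pow, ← mul_assoc, ← map_mul]

/-! ## 2. A translated slot child in regime: weights, divisibility, ledger, straightness -/

/-- **A TRANSLATED SLOT CHILD IN REGIME IS FRAMED AGAIN, every prime, any translation `β·e_u`**: from a state with `r = x_j x_i ∣ F`, order
`d + 2` (`d + 1 = p`, `2 ≤ d`), straight in support form and with the exact pair ledger, the child `step p univ j (update 0 u β) s` — if it has
order `d + 2` and `e_G = 3` — has the same weights, `x^r ∣`, the exact pair ledger (res-dim4-p-3 ♯2 `ledger_step_translate_u`), a straight
residual cone `a′·x_f^d` (`a′ ≠ 0`, §1), and the support dress «degree `d + 2` ⇒ the cone».  The `i`-slot edition is this statement with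
`j ↔ i`. [OURS] [cite: CossartJannsenSaito2020, Thm. 3.14] [cite: Hauser2010, §§F–G] -/
theorem translated_child_frame_prime (p : ℕ) [Fact p.Prime] [CharP K p] [DecidableEq K] {d : ℕ} (hdp : d + 1 = p) (hd2 : 2 ≤ d)
    {s : State K} (hr : s.r = Finsupp.single j 1 + Finsupp.single i 1) (hdiv : ∀ e ∈ s.F.support, s.r ≤ e)
    (ho : ordZero s.F = ((d + 2 : ℕ) : ℕ∞))
    (hstraight : ∀ e ∈ s.F.support, e.degree = d + 2 →
      e = Finsupp.single j 1 + Finsupp.single i 1 + Finsupp.single u 0 + Finsupp.single f d)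
    (hled : ∀ e ∈ s.F.support, e f ≤ d - 1 → 2 ≤ e j ∧ 2 ≤ e i) (β : K)
    (ho' : ordZero (CentreBlowup.step p Finset.univ j (Function.update (0 : Fin 4 → K) u β) s).F = ((d + 2 : ℕ) : ℕ∞))
    (he3' : Module.finrank K (resVertex (CentreBlowup.step p Finset.univ j (Function.update (0 : Fin 4 → K) u β) s)) = 3) :
    (CentreBlowup.step p Finset.univ j (Function.update (0 : Fin 4 → K) u β) s).r = Finsupp.single j 1 + Finsupp.single i 1 ∧
      (∀ e ∈ (CentreBlowup.step p Finset.univ j (Function.update (0 : Fin 4 → K) u β) s).F.support,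
        (CentreBlowup.step p Finset.univ j (Function.update (0 : Fin 4 → K) u β) s).r ≤ e) ∧
      (∀ e ∈ (CentreBlowup.step p Finset.univ j (Function.update (0 : Fin 4 → K) u β) s).F.support,
        e f ≤ d - 1 → 2 ≤ e j ∧ 2 ≤ e i) ∧
      (∃ a : K, a ≠ 0 ∧ resForm (CentreBlowup.step p Finset.univ j (Function.update (0 : Fin 4 → K) u β) s) = C a * X f ^ d) ∧
      (∀ e ∈ (CentreBlowup.step p Finset.univ j (Function.update (0 : Fin 4 → K) u β) s).F.support, e.degree = d + 2 →
        e = Finsupp.single j 1 + Finsupp.single i 1 + Finsupp.single u 0 + Finsupp.single f d) := by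
  classical
  set s' := CentreBlowup.step p Finset.univ j (Function.update (0 : Fin 4 → K) u β) s with hs'
  have hrj : s.r j = 1 := by rw [hr]; simp [hji]
  have hrdeg : s.r.degree = 2 := by rw [hr, map_add, Finsupp.degree_single, Finsupp.degree_single]
  have hq : ((p : ℕ) : ℕ∞) ≤ ordAlong Finset.univ s.F := by
    rw [ordAlong_univ, ho]; exact_mod_cast (by omega : p ≤ d + 2)
  have h6 : ∀ e ∈ s.F.support, d + 2 ≤ e.degree := fun e he => le_degree_of_mem_support_of_ordZero ho he
  -- weights
  have hbj : Function.update (0 : Fin 4 → K) u β j = 0 := by rw [Function.update_of_ne hju]; rfl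
  have hr' : s'.r = Finsupp.single j 1 + Finsupp.single i 1 := by
    ext k
    rw [hs', SwapTransport.step_r_apply_gen p ho j _ k]
    by_cases hkj : k = j
    · rw [if_pos hkj, hkj, Finsupp.add_apply, Finsupp.single_eq_same, Finsupp.single_eq_of_ne hji]; omega
    · rw [if_neg hkj]
      by_cases hku : k = u
      · subst hku
        rw [hr, Finsupp.add_apply, Finsupp.single_eq_of_ne hju.symm, Finsupp.single_eq_of_ne hiu.symm, add_zero]
        split_ifs <;> rfl
      · rw [if_pos (by rw [Function.update_of_ne hku]; rfl), hr]
  have hdiv' : ∀ e ∈ s'.F.support, s'.r ≤ e := SwapTransport.forall_le_step_gen (q := p) s hdiv j hbj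
  -- the exact ledger of the child (res-dim4-p-3 ♯2)
  have hled' := (ledger_step_translate_u hji hju hjf hiu hif huf p hdp hd2 s hq h6 hstraight hled β).1
  -- straightness from `e_G = 3` and the ledger (§1)
  obtain ⟨a, ha, hform'⟩ := straight_of_finrank_three_of_ledger hji hjf hif p hdp (by omega) hr' hdiv' ho' he3' hled'
  refine ⟨hr', hdiv', hled', ⟨a, ha, hform'⟩, fun e he hdeg => ?_⟩
  -- support dress of straightness
  have hrdeg' : s'.r.degree = 2 := by rw [hr', map_add, Finsupp.degree_single, Finsupp.degree_single]
  obtain ⟨-, hst⟩ := straight_readings_of_resForm_prime ho' hrdeg' hform'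
  obtain ⟨m, rfl⟩ : ∃ m, e = s'.r + m := ⟨e - s'.r, (add_tsub_cancel_of_le (hdiv' e he)).symm⟩
  have hm : m.degree = d := by rw [map_add, hrdeg'] at hdeg; omega
  by_cases hmf : m = Finsupp.single f d
  · rw [hmf, hr', Finsupp.single_zero, add_zero]
  · exact absurd (hst m hm hmf) (mem_support_iff.mp he)

end Letters

end ResCone

end Summit.ResolutionOfSingularities.ResolutionOfSingularities.Theorems.PIDim4

end
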